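import Summits.PneNP.PneNP.Theorems.ChebyshevTracialDesignTightColumnSums
import Literature.Combinatorics.AssociationSchemes.JohnsonSpectrum
import Literature.Combinatorics.Optimization.TracialDesigns
import HarnessLib

/-!
# Cell pnp-psdrank, route `ChebyshevTracialDesign`: the high Johnson layers of a test function contribute to the design value
# of `f ⊗ 1_Y` at most `Σ_c |w_c|/|Q_c| · √(Λ_c · |Y| · ‖f‖²)` (r = 1 degree truncation, high half)

Harmonic backbone of the crux `TracialDecayExp20` (stmt-PneNP-19878), brick 15 — the HIGH half of the degree-truncation identity for the
r = 1 rung (MEMO-8 §4; the low half is brick 14, `…LowDegreePricing`). For a ladder (harmonic layer) decomposition `f = Σ_j (Wᵀ)^{t−j} p_j`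
of a function on the `t`-cuts (e.g. `f = 1_X`, lit `exists_ladder_decomposition`) and its high part `f_{>K} = Σ_{j>K} (Wᵀ)^{t−j} p_j`,
every multilevel weight `W = Σ_{c∈C} w_c·1[Q_c]/|Q_c|` and every set `Y` of perfect matchings satisfy

  `|Σ_U Σ_{M∈Y} W(U,M)·f_{>K}(U)| ≤ Σ_{c∈C} (|w_c|/|Q_c|) · √(Λ_c · |Y| · Σ_{|U|=t} f(U)²)`        (`highPart_rectangle_value_le`)

whenever `Λ_c ≥ 0` bounds the ladder eigenvalues `kernelEigen n t j κ_c` of the level-`c` Gram class function `κ_c` for the deep layers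
`K < j ≤ t` (supplied for EVERY level by brick 13, `…LevelTail.kernelEigen_level_le_of_lt_uncond`, with the class functions from
`exists_levelGram_classFunction`). Mechanism: Cauchy–Schwarz over `Y` and lit's high-part Gram bound `JohnsonSpectrum.sum_sq_gram_highPart_le`
(`‖A_cᵀ f_{>K}‖² ≤ Λ_c‖f‖²`). With brick 14 this splits the value of every rectangle `X × Y` against an exact design into
`−(1/|PM|)Σ_{M∈Y} Ẽ_M[f_{≤D}]` (Grigoriev's virtual level) plus this tail. [cite: BrouwerHaemers2012, Prop. 4.3.2 (PDF p. 83)]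
[cite: Rothvoss2017, §2 (PDF p. 6)]
Stature: support/instrument. WHAT THIS IS NOT: not virtual positivity, nothing on psd rank, no P-vs-NP content. Supports stmt-PneNP-19878.
-/

set_option linter.dupNamespace false -- `Summit.PneNP.PneNP.…`: summit = sub-problem (D-0017)

noncomputable section

namespace Summit.PneNP.PneNP.Theorems.ChebyshevTracialDesignHighPartTail

open Finset Literature.Barriers.PneNP Literature.Combinatorics.Optimization
open Literature.Combinatorics.AssociationSchemes Literature.Combinatorics.AssociationSchemes.JohnsonHarmonics
open Literature.Combinatorics.AssociationSchemes.JohnsonSpectrum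
open Summit.PneNP.PneNP.Theorems.ChebyshevTracialDesignTightColumnSums

variable {n : ℕ}

/-- Level sums of a function over the odd cuts, rewritten as column sums of the level incidence on the `t`-subsets. -/
theorem sum_oddSet_level_eq_colSum {t : ℕ} (ht : Odd t) (M : PMatch n) (c : ℕ) (F : Finset (Fin n) → ℝ) :
    ∑ U : OddSet n, (if U.1.card = t ∧ cc U M = c then F U.1 else 0) =
      ∑ U ∈ univ.powersetCard t, F U * (if (U.filter fun x => M.2.partner x ∉ U).card = c then (1 : ℝ) else 0) := by
  classical
  rw [← sum_filter]
  have hfilter : univ.filter (fun U : OddSet n => U.1.card = t ∧ cc U M = c) =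
      univ.filter (fun U : OddSet n => U.1.card = t ∧ (U.1.filter fun x => M.2.partner x ∉ U.1).card = c) :=
    filter_congr fun U _ => by rw [cc_eq_card_filter_partner]
  rw [hfilter, sum_oddSet_eq_sum_powersetCard ht (fun U => (U.filter fun x => M.2.partner x ∉ U).card = c) F, sum_filter]
  exact sum_congr rfl fun U _ => by split_ifs <;> simp

/-- **The high layers of a test function against a multilevel weight and a set of matchings** (r = 1 degree truncation, high half).
For `t` odd with `2t ≤ n+1`, a ladder decomposition `Σ_j (Wᵀ)^{t−j} p_j` with harmonic layers, a truncation degree `K`, a multilevel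
weight (levels `C`, weights `w`), Gram class functions `κ_c` of the level incidences with bounds `Λ_c ≥ 0` on their layers `K < j ≤ t`,
and any set `Y` of perfect matchings:
`|Σ_U Σ_{M∈Y} levelWeight(U,M)·f_{>K}(U)| ≤ Σ_{c∈C} |w_c|/|Q_c| · √(Λ_c·|Y|·Σ_{|U|=t} f(U)²)`.
[cite: BrouwerHaemers2012, Prop. 4.3.2 (PDF p. 83)] -/
theorem highPart_rectangle_value_le {t K : ℕ} (ht : Odd t) (htn : 2 * t ≤ n + 1) (C : Finset ℕ) (w : ℕ → ℝ)
    (p : ℕ → Finset (Fin n) → ℝ) (hp : ∀ j, IsHarmonic j (p j)) (κ : ℕ → ℕ → ℝ)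
    (hA : ∀ c ∈ C, ∀ U ∈ univ.powersetCard t, ∀ U' ∈ univ.powersetCard t,
      ∑ M : PMatch n, (if (U.filter fun x => M.2.partner x ∉ U).card = c then (1 : ℝ) else 0) *
        (if (U'.filter fun x => M.2.partner x ∉ U').card = c then (1 : ℝ) else 0) = κ c (U ∩ U').card)
    (Λ : ℕ → ℝ) (hΛ0 : ∀ c ∈ C, 0 ≤ Λ c) (hΛ : ∀ c ∈ C, ∀ j, K < j → j ≤ t → kernelEigen n t j (κ c) ≤ Λ c)
    (Y : Finset (PMatch n)) :
    |∑ U : OddSet n, ∑ M ∈ Y, levelWeight n t C w U M *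
        (∑ j ∈ range (t + 1), up^[t - j] (if K < j then p j else 0)) U.1| ≤
      ∑ c ∈ C, |w c| / ((Qset n t c).card : ℝ) *
        Real.sqrt (Λ c * ((Y.card : ℝ) * ∑ U ∈ univ.powersetCard t, (∑ j ∈ range (t + 1), up^[t - j] (p j)) U ^ 2)) := by
  classical
  set h : Finset (Fin n) → ℝ := fun U => (∑ j ∈ range (t + 1), up^[t - j] (if K < j then p j else 0)) U with hh
  set N2 : ℝ := ∑ U ∈ univ.powersetCard t, (∑ j ∈ range (t + 1), up^[t - j] (p j)) U ^ 2 with hN2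
  -- Step 1: the value as level sums
  have hval : ∑ U : OddSet n, ∑ M ∈ Y, levelWeight n t C w U M * h U.1 =
      ∑ c ∈ C, w c / ((Qset n t c).card : ℝ) *
        ∑ M ∈ Y, ∑ U : OddSet n, (if U.1.card = t ∧ cc U M = c then h U.1 else 0) := by
    calc ∑ U : OddSet n, ∑ M ∈ Y, levelWeight n t C w U M * h U.1
        = ∑ U : OddSet n, ∑ M ∈ Y, ∑ c ∈ C, (if (U, M) ∈ Qset n t c then
            w c / ((Qset n t c).card : ℝ) * h U.1 else 0) := by
          refine sum_congr rfl fun U _ => sum_congr rfl fun M _ => ?_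
          rw [levelWeight, sum_mul]
          exact sum_congr rfl fun c _ => by split_ifs <;> simp
      _ = ∑ U : OddSet n, ∑ c ∈ C, ∑ M ∈ Y, (if (U, M) ∈ Qset n t c then
            w c / ((Qset n t c).card : ℝ) * h U.1 else 0) := sum_congr rfl fun U _ => sum_comm
      _ = ∑ c ∈ C, ∑ U : OddSet n, ∑ M ∈ Y, (if (U, M) ∈ Qset n t c then
            w c / ((Qset n t c).card : ℝ) * h U.1 else 0) := sum_comm
      _ = ∑ c ∈ C, w c / ((Qset n t c).card : ℝ) *
            ∑ M ∈ Y, ∑ U : OddSet n, (if U.1.card = t ∧ cc U M = c then h U.1 else 0) := by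
          refine sum_congr rfl fun c _ => ?_
          rw [mul_sum, sum_comm]
          refine sum_congr rfl fun M _ => ?_
          rw [mul_sum]
          refine sum_congr rfl fun U _ => ?_
          simp only [mem_Qset_iff]
          split_ifs <;> simp
  rw [hval]
  -- Step 2: per level, Cauchy–Schwarz over `Y` and the high-part Gram bound
  have hlevel : ∀ c ∈ C, |∑ M ∈ Y, ∑ U : OddSet n, (if U.1.card = t ∧ cc U M = c then h U.1 else 0)| ≤
      Real.sqrt (Λ c * ((Y.card : ℝ) * N2)) := by
    intro c hc
    have hcol : ∀ M : PMatch n, ∑ U : OddSet n, (if U.1.card = t ∧ cc U M = c then h U.1 else 0) =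
        ∑ U ∈ univ.powersetCard t, h U * (if (U.filter fun x => M.2.partner x ∉ U).card = c then (1 : ℝ) else 0) :=
      fun M => sum_oddSet_level_eq_colSum ht M c h
    simp only [hcol]
    refine Real.abs_le_sqrt ?_
    -- `(Σ_{M∈Y} col_M)² ≤ |Y| · Σ_{M∈Y} col_M² ≤ |Y| · Σ_M col_M² ≤ |Y| · Λ_c · ‖f‖²`
    have hCS := sum_mul_sq_le_sq_mul_sq Y (fun _ => (1 : ℝ))
      (fun M => ∑ U ∈ univ.powersetCard t, h U * (if (U.filter fun x => M.2.partner x ∉ U).card = c then (1 : ℝ) else 0))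
    simp only [one_mul, one_pow, sum_const, nsmul_eq_mul, mul_one] at hCS
    have hgram := sum_sq_gram_highPart_le htn K
      (fun U (M : PMatch n) => if (U.filter fun x => M.2.partner x ∉ U).card = c then (1 : ℝ) else 0) (κ c) (hA c hc)
      p hp (hΛ0 c hc) (hΛ c hc)
    have hsub : ∑ M ∈ Y, (∑ U ∈ univ.powersetCard t,
        h U * (if (U.filter fun x => M.2.partner x ∉ U).card = c then (1 : ℝ) else 0)) ^ 2 ≤
        ∑ M : PMatch n, (∑ U ∈ univ.powersetCard t,
          h U * (if (U.filter fun x => M.2.partner x ∉ U).card = c then (1 : ℝ) else 0)) ^ 2 :=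
      sum_le_univ_sum_of_nonneg fun M => sq_nonneg _
    calc (∑ M ∈ Y, ∑ U ∈ univ.powersetCard t,
            h U * (if (U.filter fun x => M.2.partner x ∉ U).card = c then (1 : ℝ) else 0)) ^ 2
        ≤ (Y.card : ℝ) * ∑ M ∈ Y, (∑ U ∈ univ.powersetCard t,
            h U * (if (U.filter fun x => M.2.partner x ∉ U).card = c then (1 : ℝ) else 0)) ^ 2 := hCS
      _ ≤ (Y.card : ℝ) * (Λ c * N2) :=
          mul_le_mul_of_nonneg_left (hsub.trans (by rw [hh, hN2]; exact hgram)) (Nat.cast_nonneg _)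
      _ = Λ c * ((Y.card : ℝ) * N2) := by ring
  -- Step 3: sum over the levels
  refine (abs_sum_le_sum_abs _ _).trans (sum_le_sum fun c hc => ?_)
  rw [abs_mul, abs_div, Nat.abs_cast]
  exact mul_le_mul_of_nonneg_left (hlevel c hc) (div_nonneg (abs_nonneg _) (Nat.cast_nonneg _))

end Summit.PneNP.PneNP.Theorems.ChebyshevTracialDesignHighPartTail
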